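import Literature.Analysis.Matrix.SchoenbergKernels
import Literature.MathematicalPhysics.QuantumLattice.HeatKernelGroupConvolutionProofs
import HarnessLib

/-!
# A continuous positive definite kernel has non-negative double integrals `∫∫ φ(x) φ(y) K(x,y) dμ(x) dμ(y)`

Topic `Literature/Analysis/Matrix` (next to `SchoenbergKernels.lean`, whose `IsPosDefKernel` — real case of
Berg–Christensen–Ressel, *Harmonic Analysis on Semigroups* (1984), Ch. 3 Def. 1.1: finite Gram sums
`∑ c_j c_k K(x_j, x_k) ≥ 0` — is the notion used); namespace `Literature.Analysis.Matrix`. Theorems only; no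
definition, no named fact.

**Statement** (`IsPosDefKernel.integral_integral_nonneg`). On a compact Hausdorff space `X` with a Borel probability
measure `μ`, a CONTINUOUS positive definite kernel `K` and a continuous real `φ` satisfy
`0 ≤ ∫ x, ∫ y, φ x * φ y * K x y ∂μ ∂μ` — the passage from the finite Gram sums of the definition to measures,
i.e. the kernel is of positive type in the integrated sense (BCR Ch. 4 §1; for a group kernel `K(x, y) = g(x⁻¹y)`
this is the positivity `⟪g ⋆ φ, φ⟫ ≥ 0` of the convolution operator, the form in which "g of positive type" enters
Bochner–Godement theory). Also the finite-measure version `IsPosDefKernel.integral_integral_nonneg_of_isFiniteMeasure`.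

**Measurable test functions (patch 2026-08-29, cell `ym-ir` row 47).** On a bare measurable space with a probability
(resp. finite) measure, a jointly MEASURABLE bounded positive definite kernel is of positive type against bounded MEASURABLE
real `φ`: `IsPosDefKernel.integral_prod_nonneg_of_measurable` (`0 ≤ ∫ φ(x) K(x,y) φ(y) d(μ ⊗ μ)`),
`IsPosDefKernel.integral_integral_nonneg_of_measurable` (iterated form `0 ≤ ∫∫ φ x · K x y · φ y`),
`…_of_measurable_of_isFiniteMeasure`, `IsPosDefKernel.integrable_prod_of_measurable`; the sampling identity is now the
public `integral_gramSum_pi`.  (First typed by ym-ir-idea-22 g7 in `Cruxes/IRcof/Lines/equipartition_seam_SliceKernel.lean`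
§1; same proof.)

**Proof (sampling, no metric or partition needed).** For `N` points drawn independently from `μ` — the product
measure `Measure.pi` on `Fin N → X` — the Gram sum `∑_{j,k} φ(x_j) φ(x_k) K(x_j, x_k)` is `≥ 0` pointwise by the
definition, hence so is its expectation, which is `N·D + N(N−1)·I` with `D = ∫ φ² K(x,x) dμ` (diagonal terms, the
coordinate laws are `μ`: `measurePreserving_eval`) and `I` the double integral (off-diagonal terms, the pair laws are
`μ ⊗ μ`: independence of the coordinates `iIndepFun_pi`). Letting `N → ∞` in `I ≥ −D/(N−1)` gives `I ≥ 0`.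
Product-measurability of the continuous integrand on `X × X` without second countability is the tree's
`QuantumLattice.measurable_of_continuous_prod` (Stone–Weierstrass).

## References
* C. Berg, J. P. R. Christensen, P. Ressel, *Harmonic Analysis on Semigroups* (1984), Ch. 3 Def. 1.1 (PDF p. 68),
  Ch. 4 §1. [BergChristensenRessel1984]
-/

noncomputable section

open MeasureTheory ProbabilityTheory Finset
open scoped BigOperators

namespace Literature.Analysis.Matrix

open Literature.MathematicalPhysics.QuantumLattice (measurable_of_continuous_prod)

variable {X : Type*} [TopologicalSpace X] [CompactSpace X] [T2Space X] [MeasurableSpace X] [BorelSpace X]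

omit [TopologicalSpace X] [CompactSpace X] [T2Space X] [BorelSpace X] in
/-- **The expectation of the Gram sum of `N` i.i.d. samples** (public since the 2026-08-29 patch; formerly the private
`integral_sum_sum_pi`): for a bounded product-measurable `Ψ` on `X × X` and the product probability measure on `Fin N → X`,
`∫ ∑_{j,k} Ψ(x_j, x_k) = N · ∫ Ψ(y,y) dμ + (N² − N) · ∫ Ψ d(μ ⊗ μ)` (diagonal terms have law `μ`, off-diagonal pairs law
`μ ⊗ μ`).  Only a measurable space is needed. [cite: BergChristensenRessel1984, Ch. 4 §1 (integrated positivity of positive definite kernels)] -/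
theorem integral_gramSum_pi {Ψ : X × X → ℝ} (hΨm : Measurable Ψ) {C : ℝ} (hC : ∀ p, |Ψ p| ≤ C)
    (μ : Measure X) [IsProbabilityMeasure μ] (N : ℕ) :
    ∫ x, ∑ j : Fin N, ∑ k : Fin N, Ψ (x j, x k) ∂(Measure.pi fun _ : Fin N => μ) =
      (N : ℝ) * ∫ y, Ψ (y, y) ∂μ + ((N : ℝ) ^ 2 - N) * ∫ p, Ψ p ∂(μ.prod μ) := by
  set ν : Measure (Fin N → X) := Measure.pi fun _ : Fin N => μ with hν
  -- each term is integrable (bounded and measurable)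
  have hterm_meas : ∀ j k : Fin N, Measurable fun x : Fin N → X => Ψ (x j, x k) := fun j k =>
    hΨm.comp ((measurable_pi_apply j).prodMk (measurable_pi_apply k))
  have hterm_int : ∀ j k : Fin N, Integrable (fun x : Fin N → X => Ψ (x j, x k)) ν := fun j k =>
    (integrable_const C).mono' (hterm_meas j k).aestronglyMeasurable (ae_of_all _ fun x => by
      simpa [Real.norm_eq_abs] using hC (x j, x k))
  -- diagonal terms
  have hdiag : ∀ j : Fin N, ∫ x, Ψ (x j, x j) ∂ν = ∫ y, Ψ (y, y) ∂μ := by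
    intro j
    have hmp := measurePreserving_eval (fun _ : Fin N => μ) j
    have hg : AEStronglyMeasurable (fun y : X => Ψ (y, y)) (Measure.map (Function.eval j) ν) :=
      (hΨm.comp (measurable_id.prodMk measurable_id)).aestronglyMeasurable
    rw [← hmp.map_eq, integral_map (measurable_pi_apply j).aemeasurable hg]
  -- off-diagonal terms: the pair law is `μ ⊗ μ`
  have hoff : ∀ j k : Fin N, j ≠ k → ∫ x, Ψ (x j, x k) ∂ν = ∫ p, Ψ p ∂(μ.prod μ) := by
    intro j k hjk
    have hind : iIndepFun (fun i (x : Fin N → X) => x i) ν :=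
      iIndepFun_pi (μ := fun _ : Fin N => μ) (X := fun _ => id) (fun _ => aemeasurable_id)
    have hpair := (indepFun_iff_map_prod_eq_prod_map_map (measurable_pi_apply j).aemeasurable
      (measurable_pi_apply k).aemeasurable).mp (hind.indepFun hjk)
    rw [(measurePreserving_eval (fun _ : Fin N => μ) j).map_eq,
      (measurePreserving_eval (fun _ : Fin N => μ) k).map_eq] at hpair
    have hg : AEStronglyMeasurable Ψ (Measure.map (fun x : Fin N → X => (x j, x k)) ν) :=
      hΨm.aestronglyMeasurable
    rw [← hpair, integral_map ((measurable_pi_apply j).prodMk (measurable_pi_apply k)).aemeasurable hg]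
  -- sum up
  rw [integral_finsetSum _ fun j _ => integrable_finsetSum _ fun k _ => hterm_int j k]
  simp_rw [integral_finsetSum _ fun k _ => hterm_int _ k]
  have hsplit : ∀ j : Fin N, ∑ k : Fin N, ∫ x, Ψ (x j, x k) ∂ν =
      ∫ y, Ψ (y, y) ∂μ + ((N : ℝ) - 1) * ∫ p, Ψ p ∂(μ.prod μ) := by
    intro j
    rw [← Finset.add_sum_erase _ _ (Finset.mem_univ j), hdiag j]
    congr 1
    rw [Finset.sum_congr rfl fun k hk => hoff j k (Finset.ne_of_mem_erase hk).symm, Finset.sum_const,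
      Finset.card_erase_of_mem (Finset.mem_univ j), Finset.card_univ, Fintype.card_fin, nsmul_eq_mul]
    congr 1
    rcases Nat.eq_zero_or_pos N with h0 | hpos
    · subst h0; exact (Fin.elim0 j)
    · rw [Nat.cast_sub hpos, Nat.cast_one]
  simp_rw [hsplit]
  rw [Finset.sum_const, Finset.card_univ, Fintype.card_fin, nsmul_eq_mul]
  ring

omit [TopologicalSpace X] [CompactSpace X] [T2Space X] [BorelSpace X] in
/-- ★ **Positive type in the integrated sense for bounded MEASURABLE test functions, product-measure form.** On any
measurable space with a probability measure `μ`: a positive definite kernel `K` (finite Gram sums `≥ 0`, BCR Def. 3.1.1) that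
is jointly measurable and bounded satisfies `0 ≤ ∫ φ(x) K(x,y) φ(y) d(μ ⊗ μ)` for every bounded measurable real `φ` (same
i.i.d.-sampling proof as the continuous version below; no topology needed).  Typed first as §1 of the `ym-ir` crux workfile
`Cruxes/IRcof/Lines/equipartition_seam_SliceKernel.lean` (ideator ym-ir-idea-22 g7), lifted here at the critic's request so
that transfer-kernel positivity against measurable observables has ONE home.
[cite: BergChristensenRessel1984, Ch. 3 Def. 1.1 (PDF p. 68) and Ch. 4 §1] -/
theorem IsPosDefKernel.integral_prod_nonneg_of_measurable {K : X → X → ℝ} (hK : IsPosDefKernel K)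
    (hKm : Measurable fun p : X × X => K p.1 p.2) {CK : ℝ} (hKC : ∀ x y, |K x y| ≤ CK)
    (μ : Measure X) [IsProbabilityMeasure μ] {φ : X → ℝ} (hφ : Measurable φ) {Cφ : ℝ}
    (hφC : ∀ x, |φ x| ≤ Cφ) : 0 ≤ ∫ p, φ p.1 * K p.1 p.2 * φ p.2 ∂(μ.prod μ) := by
  set Ψ : X × X → ℝ := fun p => φ p.1 * K p.1 p.2 * φ p.2 with hΨ
  have hΨm : Measurable Ψ := ((hφ.comp measurable_fst).mul hKm).mul (hφ.comp measurable_snd)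
  have hC : ∀ p, |Ψ p| ≤ Cφ * CK * Cφ := fun p => by
    have h0 : 0 ≤ Cφ := (abs_nonneg _).trans (hφC p.1)
    rw [hΨ, abs_mul, abs_mul]
    exact mul_le_mul (mul_le_mul (hφC _) (hKC _ _) (abs_nonneg _) h0) (hφC _) (abs_nonneg _)
      (mul_nonneg h0 ((abs_nonneg _).trans (hKC p.1 p.2)))
  set I := ∫ p, Ψ p ∂(μ.prod μ) with hIdef
  set D := ∫ y, Ψ (y, y) ∂μ with hDdef
  have hN : ∀ N : ℕ, 0 ≤ (N : ℝ) * D + ((N : ℝ) ^ 2 - N) * I := by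
    intro N
    rw [← integral_gramSum_pi hΨm hC μ N]
    refine integral_nonneg fun x => ?_
    have h := hK.2 N x fun j => φ (x j)
    simpa [hΨ, mul_assoc, mul_comm, mul_left_comm] using h
  show 0 ≤ I
  by_contra hneg
  push Not at hneg
  have hI' : 0 < -I := by linarith
  obtain ⟨N, hNgt⟩ := exists_nat_gt (|D| / (-I) + 1)
  have hnn : 0 ≤ |D| / (-I) := div_nonneg (abs_nonneg D) hI'.le
  have hNpos : (0 : ℝ) < N := by linarith
  have hD : |D| < ((N : ℝ) - 1) * (-I) := (div_lt_iff₀ hI').mp (by linarith)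
  have key := hN N
  have h5 : (N : ℝ) * D + ((N : ℝ) ^ 2 - N) * I = N * (D + ((N : ℝ) - 1) * I) := by ring
  have h6 : D + ((N : ℝ) - 1) * I < 0 := by linarith [le_abs_self D]
  rw [h5] at key
  exact absurd key (not_le.mpr (mul_neg_of_pos_of_neg hNpos h6))

omit [TopologicalSpace X] [CompactSpace X] [T2Space X] [BorelSpace X] in
/-- The integrand `φ(x) K(x,y) φ(y)` of the measurable version is integrable for `μ ⊗ μ` (bounded and measurable).
[cite: BergChristensenRessel1984, Ch. 4 §1] -/
theorem IsPosDefKernel.integrable_prod_of_measurable {K : X → X → ℝ}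
    (hKm : Measurable fun p : X × X => K p.1 p.2) {CK : ℝ} (hKC : ∀ x y, |K x y| ≤ CK)
    (μ : Measure X) [IsFiniteMeasure μ] {φ : X → ℝ} (hφ : Measurable φ) {Cφ : ℝ} (hφC : ∀ x, |φ x| ≤ Cφ) :
    Integrable (fun p : X × X => φ p.1 * K p.1 p.2 * φ p.2) (μ.prod μ) := by
  have hΨm : Measurable fun p : X × X => φ p.1 * K p.1 p.2 * φ p.2 :=
    ((hφ.comp measurable_fst).mul hKm).mul (hφ.comp measurable_snd)
  refine (integrable_const (Cφ * CK * Cφ)).mono' hΨm.aestronglyMeasurable (ae_of_all _ fun p => ?_)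
  rw [Real.norm_eq_abs, abs_mul, abs_mul]
  have hφ0 : 0 ≤ Cφ := (abs_nonneg _).trans (hφC p.1)
  exact mul_le_mul (mul_le_mul (hφC _) (hKC _ _) (abs_nonneg _) hφ0) (hφC _) (abs_nonneg _)
    (mul_nonneg hφ0 ((abs_nonneg _).trans (hKC p.1 p.2)))

omit [TopologicalSpace X] [CompactSpace X] [T2Space X] [BorelSpace X] in
/-- ★ **Iterated form**: `0 ≤ ∫ x, ∫ y, φ x K(x,y) φ y dμ dμ` for bounded measurable `K` (positive definite) and `φ`,
`μ` a probability measure — the clause shape in which transfer ∕ slice kernels are «of positive type» against bounded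
measurable observables (Lüscher 1977 ∕ Osterwalder–Seiler 1978 physical positivity). [cite: BergChristensenRessel1984, Ch. 4 §1] -/
theorem IsPosDefKernel.integral_integral_nonneg_of_measurable {K : X → X → ℝ} (hK : IsPosDefKernel K)
    (hKm : Measurable fun p : X × X => K p.1 p.2) {CK : ℝ} (hKC : ∀ x y, |K x y| ≤ CK)
    (μ : Measure X) [IsProbabilityMeasure μ] {φ : X → ℝ} (hφ : Measurable φ) {Cφ : ℝ}
    (hφC : ∀ x, |φ x| ≤ Cφ) : 0 ≤ ∫ x, ∫ y, φ x * K x y * φ y ∂μ ∂μ := by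
  rw [← integral_prod _ (IsPosDefKernel.integrable_prod_of_measurable hKm hKC μ hφ hφC)]
  exact hK.integral_prod_nonneg_of_measurable hKm hKC μ hφ hφC

omit [TopologicalSpace X] [CompactSpace X] [T2Space X] [BorelSpace X] in
/-- … and for a FINITE measure (scale to a probability measure; the zero measure is trivial).
[cite: BergChristensenRessel1984, Ch. 4 §1] -/
theorem IsPosDefKernel.integral_integral_nonneg_of_measurable_of_isFiniteMeasure {K : X → X → ℝ} (hK : IsPosDefKernel K)
    (hKm : Measurable fun p : X × X => K p.1 p.2) {CK : ℝ} (hKC : ∀ x y, |K x y| ≤ CK)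
    (μ : Measure X) [IsFiniteMeasure μ] {φ : X → ℝ} (hφ : Measurable φ) {Cφ : ℝ}
    (hφC : ∀ x, |φ x| ≤ Cφ) : 0 ≤ ∫ x, ∫ y, φ x * K x y * φ y ∂μ ∂μ := by
  rcases eq_zero_or_neZero μ with h0 | hne
  · subst h0; simp
  · have hc : μ Set.univ ≠ 0 := Measure.measure_univ_ne_zero.mpr (NeZero.ne μ)
    have hctop : μ Set.univ ≠ ⊤ := measure_ne_top μ _
    set P : Measure X := (μ Set.univ)⁻¹ • μ with hP
    haveI : IsProbabilityMeasure P := by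
      refine ⟨?_⟩
      rw [hP, Measure.smul_apply, smul_eq_mul, ENNReal.inv_mul_cancel hc hctop]
    have hμ : μ = (μ Set.univ) • P := by
      rw [hP, smul_smul, ENNReal.mul_inv_cancel hc hctop, one_smul]
    have hpos := hK.integral_integral_nonneg_of_measurable hKm hKC P hφ hφC
    rw [hμ, integral_smul_measure]
    simp_rw [integral_smul_measure]
    rw [integral_smul, smul_eq_mul, smul_eq_mul]
    exact mul_nonneg ENNReal.toReal_nonneg (mul_nonneg ENNReal.toReal_nonneg hpos)

/-- **A continuous positive definite kernel is of positive type in the integrated sense.** On a compact Hausdorff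
space with a Borel probability measure `μ`: if `K` is a continuous positive definite kernel (finite Gram sums
`∑ c_j c_k K(x_j,x_k) ≥ 0`, BCR Def. 3.1.1) and `φ` is continuous, then `0 ≤ ∫ x, ∫ y, φ x φ y K(x,y) dμ dμ`.
Proof: the Gram sum of `N` independent `μ`-samples has expectation `N·∫φ²K(x,x) + N(N−1)·∫∫φφK ≥ 0`; let `N → ∞`.
[cite: BergChristensenRessel1984, Ch. 3 Def. 1.1 (PDF p. 68) and Ch. 4 §1 (positive definite functions and their
integrated positivity)] -/
theorem IsPosDefKernel.integral_integral_nonneg {K : X → X → ℝ} (hK : IsPosDefKernel K)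
    (hKc : Continuous fun p : X × X => K p.1 p.2) (μ : Measure X) [IsProbabilityMeasure μ] {φ : X → ℝ}
    (hφ : Continuous φ) : 0 ≤ ∫ x, ∫ y, φ x * φ y * K x y ∂μ ∂μ := by
  -- the integrand on `X × X`
  set Ψ : X × X → ℝ := fun p => φ p.1 * φ p.2 * K p.1 p.2 with hΨ
  have hΨc : Continuous Ψ := ((hφ.comp continuous_fst).mul (hφ.comp continuous_snd)).mul hKc
  have hΨm : Measurable Ψ := measurable_of_continuous_prod hΨc
  obtain ⟨C, hC⟩ : ∃ C, ∀ p, |Ψ p| ≤ C := by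
    obtain ⟨C, hC⟩ := isCompact_univ.exists_bound_of_continuousOn hΨc.continuousOn
    exact ⟨C, fun p => by simpa [Real.norm_eq_abs] using hC p (Set.mem_univ p)⟩
  have hΨint : Integrable Ψ (μ.prod μ) :=
    (integrable_const C).mono' hΨm.aestronglyMeasurable (ae_of_all _ fun p => by
      simpa [Real.norm_eq_abs] using hC p)
  -- the double integral is the product integral
  have hI : ∫ x, ∫ y, φ x * φ y * K x y ∂μ ∂μ = ∫ p, Ψ p ∂(μ.prod μ) := by
    rw [integral_prod Ψ hΨint]
  rw [hI]
  set I := ∫ p, Ψ p ∂(μ.prod μ) with hIdef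
  set D := ∫ y, Ψ (y, y) ∂μ with hDdef
  -- expectation of the Gram sums: `0 ≤ N·D + (N² − N)·I`
  have hN : ∀ N : ℕ, 0 ≤ (N : ℝ) * D + ((N : ℝ) ^ 2 - N) * I := by
    intro N
    rw [← integral_gramSum_pi hΨm hC μ N]
    refine integral_nonneg fun x => ?_
    have h := hK.2 N x fun j => φ (x j)
    simpa [hΨ, mul_assoc, mul_comm, mul_left_comm] using h
  -- let `N → ∞`: if `I < 0`, pick `N` with `(N − 1)(−I) > |D|`
  by_contra hneg
  push Not at hneg
  have hI' : 0 < -I := by linarith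
  obtain ⟨N, hNgt⟩ := exists_nat_gt (|D| / (-I) + 1)
  have hnn : 0 ≤ |D| / (-I) := div_nonneg (abs_nonneg D) hI'.le
  have hNpos : (0 : ℝ) < N := by linarith
  have hD : |D| < ((N : ℝ) - 1) * (-I) := (div_lt_iff₀ hI').mp (by linarith)
  have key := hN N
  have h5 : (N : ℝ) * D + ((N : ℝ) ^ 2 - N) * I = N * (D + ((N : ℝ) - 1) * I) := by ring
  have h6 : D + ((N : ℝ) - 1) * I < 0 := by linarith [le_abs_self D]
  rw [h5] at key
  exact absurd key (not_le.mpr (mul_neg_of_pos_of_neg hNpos h6))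

/-- The same for a FINITE Borel measure (scale to a probability measure; the zero measure is trivial).
[cite: BergChristensenRessel1984, Ch. 3 Def. 1.1 (PDF p. 68) and Ch. 4 §1] -/
theorem IsPosDefKernel.integral_integral_nonneg_of_isFiniteMeasure {K : X → X → ℝ} (hK : IsPosDefKernel K)
    (hKc : Continuous fun p : X × X => K p.1 p.2) (μ : Measure X) [IsFiniteMeasure μ] {φ : X → ℝ}
    (hφ : Continuous φ) : 0 ≤ ∫ x, ∫ y, φ x * φ y * K x y ∂μ ∂μ := by
  rcases eq_zero_or_neZero μ with h0 | hne
  · subst h0; simp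
  · have hc : μ Set.univ ≠ 0 := Measure.measure_univ_ne_zero.mpr (NeZero.ne μ)
    have hctop : μ Set.univ ≠ ⊤ := measure_ne_top μ _
    set P : Measure X := (μ Set.univ)⁻¹ • μ with hP
    haveI : IsProbabilityMeasure P := by
      refine ⟨?_⟩
      rw [hP, Measure.smul_apply, smul_eq_mul, ENNReal.inv_mul_cancel hc hctop]
    have hμ : μ = (μ Set.univ) • P := by
      rw [hP, smul_smul, ENNReal.mul_inv_cancel hc hctop, one_smul]
    have hpos := hK.integral_integral_nonneg hKc P hφ
    rw [hμ, integral_smul_measure]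
    simp_rw [integral_smul_measure]
    rw [integral_smul, smul_eq_mul, smul_eq_mul]
    exact mul_nonneg ENNReal.toReal_nonneg (mul_nonneg ENNReal.toReal_nonneg hpos)

end Literature.Analysis.Matrix
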